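import Summits.BirchSwinnertonDyer.BirchSwinnertonDyer.Theorems.KolyvaginRoadThreePTDescentLocalData
import HarnessLib

/-!
# `K'` spans `K'_w` over `K_v`, and rigidity of completions, for ANY finite `K'/K`

Route `KolyvaginRoadThree`, crux `ZhangSharpFrameAtThreeHL` (stmt-BirchSwinnertonDyer-19574), PT road
(C), inputs of the double-coset dictionary (`KolyvaginRoadThreePTDescentDictionary`, binder (N2) `hsemi`
of `middleExact_canonical_of_descentData`, p555478).  For a finite extension of number fields `K'/K`
(NOT assumed Galois), a finite place `v` of `K` and places `w, w₁, w₂ ∣ v` of `K'` (`SemiLocal.Place`,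
`K'_w` a `K_v`-algebra by `SemiLocal.algebraPlace`):

* `span_range_algebraMap_place_eq_top` — **`K'` spans `K'_w` over `K_v`**: the `K_v`-span of `K'` is a
  finite-dimensional subspace of `K'_w` over the complete field `K_v` (`finiteDimensional_place'`),
  hence closed, and contains the dense subfield `K'` (the tree's `SemiLocal.span_range_coe_eq_top`
  assumes `K'/K` Galois, via the normal basis);
* `place_eq_of_algHom'` — **rigidity**: a `K_v`-algebra map `K'_{w₁} → K'_{w₂}` over `K'` forces
  `w₁ = w₂` (the tree's `SemiLocal.place_eq_of_algHom` without the Galois hypothesis; same proof).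

THEOREMS only (no definition, no named fact, no instance); no case of BSD.

References: [CasselsFrohlichANT1967] Ch. II §10; [NeukirchANT1999] Ch. II (8.2)–(8.4).
-/

noncomputable section

open Function NumberField IsDedekindDomain
open scoped NumberField Classical

set_option linter.dupNamespace false
set_option autoImplicit false

namespace Summit.BirchSwinnertonDyer.BirchSwinnertonDyer.Theorems.KolyvaginRoadThreePT

open Field
open Literature.NumberTheory.GaloisRepresentations
open Literature.NumberTheory.GaloisRepresentations.SemiLocal (Place algebraPlace)
open Literature.NumberTheory.NumberFields
open Literature.NumberTheory.Automorphic

section CompletionSpan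

variable {K K' : Type} [Field K] [NumberField K] [Field K'] [NumberField K'] [Algebra K K']
variable (v : HeightOneSpectrum (𝓞 K))

/-! ## `K'` spans `K'_w` over `K_v` -/

/-- **`K'` spans `K'_w` over `K_v`** for ANY finite extension `K'/K` of number fields and `w ∣ v`:
the `K_v`-span of `K'` is a finite-dimensional subspace of `K'_w` (over the complete field `K_v`),
hence closed, and it contains the dense subfield `K'`. [cite: CasselsFrohlichANT1967, Ch. II §10] -/
theorem span_range_algebraMap_place_eq_top (w : Place K K' v) :
    Submodule.span (v.adicCompletion K)
      (Set.range (algebraMap K' ((w : HeightOneSpectrum (𝓞 K')).adicCompletion K'))) = ⊤ := by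
  haveI := finiteDimensional_place' v w
  letI : NontriviallyNormedField (v.adicCompletion K) :=
    Valued.toNontriviallyNormedField (v.adicCompletion K) (WithZero (Multiplicative ℤ))
  haveI : ContinuousSMul (v.adicCompletion K) ((w : HeightOneSpectrum (𝓞 K')).adicCompletion K') :=
    continuousSMul_of_algebraMap _ _
      (continuous_adicCompletionOfLiesOver K K' v (w : HeightOneSpectrum (𝓞 K')))
  set S := Submodule.span (v.adicCompletion K)
      (Set.range (algebraMap K' ((w : HeightOneSpectrum (𝓞 K')).adicCompletion K'))) with hS
  have hclosed : IsClosed (S : Set ((w : HeightOneSpectrum (𝓞 K')).adicCompletion K')) :=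
    S.closed_of_finiteDimensional
  have hdense : DenseRange (algebraMap K' ((w : HeightOneSpectrum (𝓞 K')).adicCompletion K')) :=
    HeightOneSpectrum.denseRange_algebraMap K' (w : HeightOneSpectrum (𝓞 K'))
  refine eq_top_iff.mpr fun y _ => ?_
  have hy : y ∈ closure (Set.range (algebraMap K' ((w : HeightOneSpectrum (𝓞 K')).adicCompletion K'))) := by
    rw [hdense.closure_eq]; trivial
  exact hclosed.closure_subset_iff.mpr Submodule.subset_span hy

/-! ## Rigidity without the Galois hypothesis -/

/-- **Rigidity of completions** (the tree's `SemiLocal.place_eq_of_algHom` without the Galois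
hypothesis, same proof with `finiteDimensional_place'`): a `K_v`-algebra homomorphism
`Θ : K'_{w₁} → K'_{w₂}` restricting to the identity of `K'` forces `w₁ = w₂` (`Θ` is continuous;
`eᵏ → 0` in `K'_{w₁}` but `|eᵏ|_{w₂} = 1` for `e ∈ 𝔭_{w₁} ∖ 𝔭_{w₂}`).
[cite: CasselsFrohlichANT1967, Ch. II §10] -/
theorem place_eq_of_algHom' {w₁ w₂ : Place K K' v}
    (Θ : ((w₁ : HeightOneSpectrum (𝓞 K')).adicCompletion K') →ₐ[v.adicCompletion K]
      ((w₂ : HeightOneSpectrum (𝓞 K')).adicCompletion K'))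
    (hΘ : ∀ e : K', Θ (algebraMap K' ((w₁ : HeightOneSpectrum (𝓞 K')).adicCompletion K') e) =
      algebraMap K' ((w₂ : HeightOneSpectrum (𝓞 K')).adicCompletion K') e) : w₁ = w₂ := by
  -- adapted from Literature/NumberTheory/GaloisRepresentations/CompletionCompositum.place_eq_of_algHom
  by_contra hne
  have hne' : (w₁ : HeightOneSpectrum (𝓞 K')) ≠ w₂ := fun h => hne (Place.ext h)
  have hP : ¬ (w₁ : HeightOneSpectrum (𝓞 K')).asIdeal ≤ (w₂ : HeightOneSpectrum (𝓞 K')).asIdeal := by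
    intro hle
    exact hne' (HeightOneSpectrum.ext
      ((w₁ : HeightOneSpectrum (𝓞 K')).isMaximal.eq_of_le (w₂ : HeightOneSpectrum (𝓞 K')).isPrime.ne_top
        hle))
  obtain ⟨r, hr₁, hr₂⟩ := Set.not_subset.mp hP
  set e : K' := algebraMap (𝓞 K') K' r with he
  have hval : ∀ u : HeightOneSpectrum (𝓞 K'),
      Valued.v (algebraMap K' (u.adicCompletion K') e) = u.intValuation r := fun u => by
    rw [HeightOneSpectrum.algebraMap_adicCompletion, Function.comp_apply, Algebra.algebraMap_self,
      RingHom.id_apply, HeightOneSpectrum.valuedAdicCompletion_eq_valuation', he,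
      HeightOneSpectrum.valuation_of_algebraMap]
  have hv₁ : Valued.v (algebraMap K' ((w₁ : HeightOneSpectrum (𝓞 K')).adicCompletion K') e) < 1 :=
    (hval _).trans_lt (((w₁ : HeightOneSpectrum (𝓞 K')).intValuation_lt_one_iff_mem r).mpr hr₁)
  have hv₂ : Valued.v (algebraMap K' ((w₂ : HeightOneSpectrum (𝓞 K')).adicCompletion K') e) = 1 :=
    (hval _).trans (le_antisymm ((w₂ : HeightOneSpectrum (𝓞 K')).intValuation_le_one r)
      (not_lt.mp fun h => hr₂ (((w₂ : HeightOneSpectrum (𝓞 K')).intValuation_lt_one_iff_mem r).mp h)))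
  -- normed structures
  letI : NontriviallyNormedField (v.adicCompletion K) :=
    Valued.toNontriviallyNormedField (v.adicCompletion K) (WithZero (Multiplicative ℤ))
  letI h₁ : NormedField ((w₁ : HeightOneSpectrum (𝓞 K')).adicCompletion K') :=
    Valued.toNormedField ((w₁ : HeightOneSpectrum (𝓞 K')).adicCompletion K') (WithZero (Multiplicative ℤ))
  letI h₂ : NormedField ((w₂ : HeightOneSpectrum (𝓞 K')).adicCompletion K') :=
    Valued.toNormedField ((w₂ : HeightOneSpectrum (𝓞 K')).adicCompletion K') (WithZero (Multiplicative ℤ))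
  have hcont : Continuous Θ := by
    haveI := finiteDimensional_place' v w₁
    haveI : ContinuousSMul (v.adicCompletion K) ((w₁ : HeightOneSpectrum (𝓞 K')).adicCompletion K') :=
      continuousSMul_of_algebraMap _ _
        (continuous_adicCompletionOfLiesOver K K' v (w₁ : HeightOneSpectrum (𝓞 K')))
    haveI : ContinuousSMul (v.adicCompletion K) ((w₂ : HeightOneSpectrum (𝓞 K')).adicCompletion K') :=
      continuousSMul_of_algebraMap _ _
        (continuous_adicCompletionOfLiesOver K K' v (w₂ : HeightOneSpectrum (𝓞 K')))
    exact LinearMap.continuous_of_finiteDimensional Θ.toLinearMap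
  -- `eᵏ → 0` in `K'_{w₁}`, so `Θ(eᵏ) = eᵏ → 0` in `K'_{w₂}`
  have hlim₁ : Filter.Tendsto
      (fun k : ℕ => (algebraMap K' ((w₁ : HeightOneSpectrum (𝓞 K')).adicCompletion K') e) ^ k)
      Filter.atTop (nhds 0) :=
    tendsto_pow_atTop_nhds_zero_of_norm_lt_one ((Valued.toNormedField.norm_lt_one_iff).mpr hv₁)
  have hlim₂ : Filter.Tendsto
      (fun k : ℕ => (algebraMap K' ((w₂ : HeightOneSpectrum (𝓞 K')).adicCompletion K') e) ^ k)
      Filter.atTop (nhds 0) := by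
    have := (hcont.tendsto 0).comp hlim₁
    rw [map_zero] at this
    refine this.congr fun k => ?_
    simp only [Function.comp_apply, map_pow, hΘ]
  -- but `‖eᵏ‖ = 1` in `K'_{w₂}`
  have hnorm : ∀ k : ℕ,
      ‖(algebraMap K' ((w₂ : HeightOneSpectrum (𝓞 K')).adicCompletion K') e) ^ k‖ = 1 := fun k => by
    have h1 : ‖algebraMap K' ((w₂ : HeightOneSpectrum (𝓞 K')).adicCompletion K') e‖ = 1 :=
      le_antisymm (Valued.toNormedField.norm_le_one_iff.mpr hv₂.le)
        (Valued.toNormedField.one_le_norm_iff.mpr hv₂.ge)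
    rw [norm_pow, h1, one_pow]
  have h0 : ‖(0 : (w₂ : HeightOneSpectrum (𝓞 K')).adicCompletion K')‖ = 1 := by
    have hc := (continuous_norm.tendsto _).comp hlim₂
    have hconst : (fun k : ℕ =>
        ‖(algebraMap K' ((w₂ : HeightOneSpectrum (𝓞 K')).adicCompletion K') e) ^ k‖) =
        fun _ => (1 : ℝ) := funext hnorm
    rw [show ((fun x => ‖x‖) ∘ fun k : ℕ =>
        (algebraMap K' ((w₂ : HeightOneSpectrum (𝓞 K')).adicCompletion K') e) ^ k) =
        fun _ => (1 : ℝ) from hconst] at hc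
    exact tendsto_nhds_unique hc tendsto_const_nhds
  rw [norm_zero] at h0
  exact zero_ne_one h0

end CompletionSpan

end Summit.BirchSwinnertonDyer.BirchSwinnertonDyer.Theorems.KolyvaginRoadThreePT

end
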